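import Summits.HodgeConjecture.HodgeConjecture.Theorems.F0P6aStubE6Sockets               -- ★ RE-HOMED E6 socket words (Theorems currency, ns `…Cruxes.HLiu418.F0P6aStubE6` kept): `RingActionReading`
import Summits.HodgeConjecture.HodgeConjecture.Theorems.F0P6aChartFramePin                 -- ★ RE-HOMED frame pin `IsChartOfFrame` (+ ★ `Theorems.F0P6aPELWitnessEDefs`: `AuxChartGS`, `IsCMTypeThrough`, `GSAdele`)
import Literature.AlgebraicGeometry.ShimuraVarieties.UnitaryAuxiliaryTorusDatum                       -- ★ `Aux.reflexField`, `Aux.numberField_reflexField`, `Aux.torusFinAdelic`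
import Literature.NumberTheory.ComplexMultiplication.ReflexNormIdeles                                  -- ★ `reflexNormFiniteIdele`
import Literature.NumberTheory.ComplexMultiplication.CMTypeBasic                                         -- ★ `CMTypeOps.flip`, `CMTypeOps.bar`
import Literature.NumberTheory.Automorphic.IdeleIdealClass                                            -- ★ `FiniteAdeleRing.toFractionalIdeal`
import Literature.NumberTheory.GaloisRepresentations.HeckeCharacterOfRayClass                          -- ★ `modulusExp`
import Literature.NumberTheory.NumberFields.IdealClassCoprimeRepresentative                       -- ★ `mul_pointwise_smul_sup_eq_top_of_sup_span_natCast_eq_top` (§J glue (b′))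
import Literature.AlgebraicGeometry.AbelianSchemes.SerreTwistModuliTupleRowA                      -- ★ p850615: `serreTensor`, `serreTranslate`, `serreAction`, `IsExactTwistPol` (the twisted-tuple vocabulary)
import Literature.AlgebraicGeometry.AbelianSchemes.AbelianSchemeFixedPowBaseChange                 -- ★ `RingAction.baseChange`
import Literature.AlgebraicGeometry.Motives.GaloisThickening                                      -- ★ `thickeningLift` (the sheet sections `ℓ_e`)
import Literature.AlgebraicGeometry.Motives.JacobianGaloisDescent                                 -- ★ `GaloisDescent.gal` (`1 × Spec γ⁻¹`)
import HarnessLib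

/-!
# Crux `HLiu418` — (S8) closer `Lines/F0_P6a_StubESHEET.lean` ED. 2 (tree d582eb44), socket `hole_SHEET_global : OrganSHEETGlobal`, ROAD OF RECORD v3 (γ′)
# «SERRE TENSOR OVER `X`, CLASSIFIED»: **THE STATEMENT LAYER OF LEG-E(γ′) GLOBAL GLUE IN THEOREMS CURRENCY** — the junction `IsSheetTwistOf` (by copy), the three
# organ letters `OrganB1` («fibre lift»), `OrganB2` (DEAL #38 «`ε₂` reads the twisted point map»), `OrganB3` ((R-CM) «`hact` at the special sheet points»), and the
# socket text `OrganSHEETGlobal` (= tree ED. 2 §3c TOKEN FOR TOKEN).  DEFINITIONS ONLY; nothing asserted.  (The four closed organ letters carry `(print: …)` locators,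
# not `[cite: …]` tags: they are Summits-side sockets, not Literature facts — the gate relocates cited closed `def : Prop`s.)

Cell `hodgecm-mathlib` (D-0151), FLOOR 0, P6 «MOD», half A line L7∕L4; crux `stmt-HodgeConjecture-24832` (hLiu418); `--supports` only, count-neutral.  LA4-plan (g2) (T) GO
2026-09-02 10:10:04Z + DEALS #45∕#46 10:10:34Z: the organ payers (`organB1_holds` ★ p850896 LA5-p02 (g4); `organB2_holds` #45 LA4-p02 (g2); `organB3_holds` #46 LA6-p02 (g3))
state their heads against THESE constants BY IMPORT; the proof file `Theorems/F0P6aStubESHEETGlobalGlue.lean` (LA7-p01 (g4)) proves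
`organSHEETGlobal_of_organs : OrganB1 → OrganB2 → OrganB3 → OrganSHEETGlobal` and `organSHEETGlobal_holds`.  THEOREMS CURRENCY: this module imports ONLY the ★
re-homed twins `Theorems.F0P6aStubE6Sockets` ∕ `Theorems.F0P6aChartFramePin` ∕ `Theorems.F0P6aPELWitnessEDefs` (namespaces kept, FQNs identical to the `Lines/`
originals) and ★ Literature — never a `Lines/` module («M-72» (3)); after the «K3» shim flip the Lines closer imports the proof file and pays `hole_SHEET_global` by
one `exact` (the two `IsSheetTwistOf` ∕ `OrganSHEETGlobal` copies are delta-equal over then-identical constants).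

THE MATHEMATICS ([Shimura1998] §18.6 Thm. 18.6; [Milne2005ShimuraVarieties] Thm. 13.6; [MumfordFogartyKirwan1994] Ch. 7 §2–§3; [RapoportSmithlingZhang2020Diagonal] §3.2,
§4.3).  In the letter՚s chart context (record system `S`, small level `Kc`, slice field `Fᵢ ⊇ F` with complex place `τE ∣ ι₁`, chart `C` pinned on the frame `Fr`,
slice `ε : X := (M_Kc) ⊗_F Fᵢ → 𝓜.M ⊗_ℚ Fᵢ` reading `C.f`, `𝒪_F`-action `ρ` on the pull-back `P := 𝓜.univ ×_{𝓜.M} X` with its READING) and a junction datum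
`IsSheetTwistOf ι₁ τE Φ hΦ C.N γ 𝔞 n`, the global sheet law `OrganSHEETGlobal` says: the Serre-twisted `𝒪_F`-PEL tuple `(B, actB, DB, λ_B, η_B)` over `X` exists with its
cover `c : P.A → B` (rows (t1)(t1′)(surj)(t2)(t3)(t4)(t5)(t5′)) AND an isomorphism of group schemes `E : B ≅ (P.A) ×_X (1 × Spec γ)` over `X` exact on `λ`, on the
level sections and on the `𝒪_F`-actions.  The three organ letters are exactly what the glue consumes beyond ★: (B1) one symplectic lift of `η_B` at every special
sheet point (⇒ `HasType δ` + `IsSymplecticLiftable` by ★ p850824∕p850691); (B2) the classifying `Fᵢ`-slice of the twisted tuple reads the twisted point map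
`[v, a] ↦ C.pts⁻¹[C.J v, C.b a · ũ_V(1, z)]`; (B3) at every special sheet point the tuple isomorphism intertwines `serreAction` and `ρ ×_X (1 × Spec γ)`.
HONEST LABEL: HC_CM is proved only modulo the 7 printed citations (2 remaining: hLiu418 = stmt-HodgeConjecture-24832, h413 = stmt-HodgeConjecture-24833) until rung 0 closes.
[cite: Shimura1998, §18.6 Thm. 18.6 pp. 124–125, proof pp. 127–129] [cite: Milne2005ShimuraVarieties, §13 Lemma 13.5 and Thm. 13.6 (p. 118)]
[cite: MumfordFogartyKirwan1994, Ch. 7 §2 Definition 7.2 (p. 129), §3 Theorem 7.9 (p. 139)] [cite: RapoportSmithlingZhang2020Diagonal, §3.2 p. 11, §4.3 p. 20]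
-/

set_option autoImplicit false

noncomputable section

set_option linter.dupNamespace false  -- `Summit.HodgeConjecture.HodgeConjecture.…` BY DESIGN (D-0017)

/-! ## §J THE JUNCTION BY COPY — closer `Lines/F0_P6a_StubESHEET.lean` (ED. 1 462ab2e6 = ED. 2 d582eb44 here) §1 VERBATIM in the glue namespace
(`twistType`, `IsSheetTwistOf`; the §1b glue lemmas `coprime_norm_level` ∕ `norm_ne_zero` travel with the proof file);
kept BY COPY in this Theorems-currency file (the closer is a `Lines/` module and cannot be imported here — «M-72» (3)); the two copies are delta-equal. -/

namespace Summit.HodgeConjecture.HodgeConjecture.Theorems.F0P6aStubESHEETGlobalGlue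

open CategoryTheory CategoryTheory.Limits NumberField IsDedekindDomain MulAction AlgebraicGeometry
open scoped Matrix Polynomial Pointwise nonZeroDivisors
open Literature.NumberTheory.GaloisRepresentations
open Literature.NumberTheory.Automorphic Literature.NumberTheory.Automorphic.UnitaryGroup
open Literature.AlgebraicGeometry.ShimuraVarieties Literature.AlgebraicGeometry.ShimuraVarieties.UnitaryCanonicalModel
open Literature.NumberTheory.Automorphic.Liu2021.AppendixC
open Literature.AlgebraicGeometry.Motives (AlgPoints ComplexPoints SchemeOver thickeningLift specOver CMType)
open Literature.AlgebraicGeometry.Motives.AbelianVariety (bcSpec)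
open Summit.HodgeConjecture.HodgeConjecture.Cruxes.HLiu418.F0P6aPELWitnessE
open Literature.AlgebraicGeometry.ShimuraVarieties.UnitaryCanonicalModel.Aux (ratBasis torusFinAdelic reflexField numberField_reflexField)
open Literature.NumberTheory.ComplexMultiplication (reflexNormFiniteIdele)
open Literature.NumberTheory.ComplexMultiplication.CMTypeOps (flip bar)

/-! ### §1 The junction: the chart՚s twist type and `IsSheetTwistOf` -/

/-- **The chart՚s CM type `Φ_tw := flip ι₁ (bar Φ)`** — the type the frame pin puts on the chart (`C.J = auxComplexStructureV Fr ι₁ (flip ι₁ (bar Φ))`, pin leaf),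
equivalently the «twist type» `{φ | mOf ι₁ Φ φ ≠ 0 ∧ φ ≠ ῑ₁} = {ι₁} ∪ {φ̄ | φ ∈ Φ, φ ≠ ι₁}` of ★ `F0P6aCanonicalTwistIdealAsReflexTypeNorm`; its reflex compositum
`E♯ = Aux.reflexField F Φ_tw ι₁` (`= ι₁(F)` for `F∕ℚ` Galois, ★ `Aux.reflexField_le_fieldRange_of_isGalois`) carries the correspondents `sE`, and its reflex norm
`t = reflexNormFiniteIdele F Φ_tw E♯` is the torus coordinate of ★ (S2a).  THE ONE TOKEN TO CHANGE if the E-pen normalises the twist on the swapped type.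
[cite: RapoportSmithlingZhang2020Diagonal, §3.2 (3.8) p. 11] [cite: Shimura1998, §18.6 (2) p. 128] -/
def twistType {F : Type} [Field F] (ι₁ : F →+* ℂ) (Φ : Set (F →+* ℂ)) (hΦ : IsCMTypeThrough ι₁ Φ) : CMType F :=
  flip ι₁ (bar (⟨Φ, hΦ.2⟩ : CMType F))

set_option maxHeartbeats 400000 in
/-- **THE JUNCTION `IsSheetTwistOf ι₁ τE Φ hΦ N γ 𝔞 n`** («`(𝔞, n)` IS a sheet twist of `γ ∈ Gal(Fᵢ∕F)` at level `N`»): the integrality rows (a) `(n) = 𝔞𝔞̄`,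
(b) `𝔞 ⊔ (N) = ⊤`, (c) `𝔞 ≠ 0`, AND a lift `γ̃ : ℂ ≃+* ℂ` of `γ` through `τE` fixing `ι₁F` pointwise, an EXACT `E♯`-correspondent `sE` of `γ̃`
(★ `IsArtinCorrespondent`), and a finite idèle `z` of `F` with `z = t(sE)` in `(𝔸_{F,f})ˣ` (A-p01 (g28) 06:45:14Z: PINNED to a correspondent, no `F^×`-coset; orientation LA4-p05 (g4) 07:19:22Z), `[z] = 𝔞⁻¹` and `z ≡ 1 mod (N)`
(valuation form, ★ p849693՚s output shape).  Produced by (S6)∕(S7) (`OrganTWIST`), consumed by (S2b)∕(S3♯)∕(S4) (`OrganSHEET`): `ψ_𝔞[v, a] = [J v, b(a)·ũ_V(1, z)]`.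
JUNCTION FROZEN at the v2 rows (LA7-p01 (g3) LEGPLAN (M2) ∕ dealer ruling 07:43:53Z ∕ E-dealer A-p01 (g28) 07:44:27Z «=», 2026-09-02): NO row (d) `𝔞 ⊔ c𝔞 = ⊤`
(organ-internal where a leg wants it: ★ `splitPrime_typeProd_twistRows` ∕ ★ `canonicalTwistIdeal_sup_complexConj_smul_eq_top_sigma`), NO row (e) `Nat.Coprime n (∏ δᵢ)` (unpayable on the
Frobenius coset by (FROB-n); unneeded on road B′ «Serre tensor per complex fibre»); (b′) `Nat.Coprime n N` is READ OFF rows (a)(b) — glue `IsSheetTwistOf.coprime_norm_level` (§1b).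
A `Prop`; nothing asserted.  [cite: Shimura1998, §18.6 proof pp. 127–129] [cite: MilneCM2006, Ch. I §1 Rem. 1.25, Prop. 1.26] [cite: Milne2005ShimuraVarieties, Def. 12.8 (59)–(62) p. 114] -/
def IsSheetTwistOf {F : Type} [Field F] [NumberField F] [IsCMField F] (ι₁ : F →+* ℂ)
    {Fi : Type} [Field Fi] [Algebra F Fi] (τE : Fi →+* ℂ) (Φ : Set (F →+* ℂ)) (hΦ : IsCMTypeThrough ι₁ Φ) (N : ℕ)
    (γ : Fi ≃ₐ[F] Fi) (𝔞 : Ideal (𝓞 F)) (n : ℕ) : Prop :=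
  Ideal.span {((n : ℕ) : 𝓞 F)} = 𝔞 * (IsCMField.complexConj F) • 𝔞 ∧
  𝔞 ⊔ Ideal.span {((N : ℕ) : 𝓞 F)} = ⊤ ∧ 𝔞 ≠ ⊥ ∧
  haveI : NumberField ↥(reflexField F (twistType ι₁ Φ hΦ) ι₁) := numberField_reflexField F (twistType ι₁ Φ hΦ) ι₁
  ∃ (γ' : ℂ ≃+* ℂ) (sE : (FiniteAdeleRing (𝓞 ↥(reflexField F (twistType ι₁ Φ hΦ) ι₁)) ↥(reflexField F (twistType ι₁ Φ hΦ) ι₁))ˣ)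
    (z : (FiniteAdeleRing (𝓞 F) F)ˣ),
    (∀ x : Fi, γ' (τE x) = τE (γ x)) ∧ (∀ x : F, γ' (ι₁ x) = ι₁ x) ∧
    IsArtinCorrespondent ↥(reflexField F (twistType ι₁ Φ hΦ) ι₁) (algebraMap ↥(reflexField F (twistType ι₁ Φ hΦ) ι₁) ℂ) sE γ' ∧
    z = reflexNormFiniteIdele F (twistType ι₁ Φ hΦ) (reflexField F (twistType ι₁ Φ hΦ) ι₁) sE ∧
    FiniteAdeleRing.toFractionalIdeal (𝓞 F) F z = ((𝔞 : FractionalIdeal (𝓞 F)⁰ F))⁻¹ ∧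
    ∀ v : HeightOneSpectrum (𝓞 F), Ideal.span {((N : ℕ) : 𝓞 F)} ≤ v.asIdeal →
      Valued.v ((z : FiniteAdeleRing (𝓞 F) F) v) = 1 ∧
      Valued.v ((z : FiniteAdeleRing (𝓞 F) F) v - 1) ≤ WithZero.exp (-(modulusExp (Ideal.span {((N : ℕ) : 𝓞 F)}) v : ℤ))

end Summit.HodgeConjecture.HodgeConjecture.Theorems.F0P6aStubESHEETGlobalGlue

/-! ## §2 THE ORGAN LETTERS (B1)(B2)(B3) AND THE SOCKET TEXT `OrganSHEETGlobal` -/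

namespace Summit.HodgeConjecture.HodgeConjecture.Theorems.F0P6aStubESHEETGlobalGlue

open CategoryTheory CategoryTheory.Limits NumberField IsDedekindDomain MulAction AlgebraicGeometry Topology
open scoped Matrix Polynomial Pointwise nonZeroDivisors MonObj  -- `MonObj`: the unit morphism `1 : T ⟶ A.X` (★ `Hom.monoid`); it also makes `γ` a token (★ `Mod`), hence the binder `γ₁`
open Literature.NumberTheory.GaloisRepresentations
open Literature.NumberTheory.Automorphic Literature.NumberTheory.Automorphic.UnitaryGroup
open Literature.AlgebraicGeometry.ShimuraVarieties Literature.AlgebraicGeometry.ShimuraVarieties.UnitaryCanonicalModel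
open Literature.NumberTheory.Automorphic.Liu2021.AppendixC
open Literature.AlgebraicGeometry.Motives (AlgPoints ComplexPoints SchemeOver thickeningLift specOver CartierDivisor CMType)
open Literature.AlgebraicGeometry.Motives.AbelianVariety (bcSpec)
open Literature.AlgebraicGeometry.AbelianSchemes (PolarizedAbelianSchemeWithLevel AbelianSchemeOver)
open Literature.AlgebraicGeometry.ModuliOfAbelianVarieties
open Summit.HodgeConjecture.HodgeConjecture.Cruxes.HLiu418.F0P6aPELWitnessE
open Summit.HodgeConjecture.HodgeConjecture.Cruxes.HLiu418.F0P6aStubE6 (RingActionReading)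
open Summit.HodgeConjecture.HodgeConjecture.Cruxes.HLiu418.F0P6aChartFramePin (IsChartOfFrame)
open Literature.AlgebraicGeometry.ShimuraVarieties.UnitaryCanonicalModel.Aux (ratBasis torusFinAdelic reflexField numberField_reflexField)
open Literature.AlgebraicGeometry.ShimuraVarieties.UnitaryCurve Literature.AlgebraicGeometry.ShimuraVarieties.UnitaryCurve.AuxV
open Literature.NumberTheory.ComplexMultiplication (reflexNormFiniteIdele)
open Literature.NumberTheory.ComplexMultiplication.CMTypeOps (flip bar)

/-! ### §2a ORGAN (B1) «FIBRE LIFT» — one symplectic lift of the twisted level structure at every special sheet point -/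

set_option maxHeartbeats 400000 in
/-- **ORGAN (B1) «FIBRE LIFT AT THE SPECIAL SHEET POINTS»** (hands: (N3) LA4-p05 (g4) ★ `hasType_of_markedComplexFibre_comp`՚s lift + the marked twisted fibre
at `ℓ_{τE} z₀` (σ1-UNPACK ★ p850665, ★ p850517, adapters)).  In the letter՚s chart context, for ideal data `(𝔞, n)` with rows (c)(a)(b) and a torus idèle `t` with
`[t] = 𝔞⁻¹`, `t ≡ 1 mod N` (the junction՚s `z = t(sE)`), for every Serre presentation `(E′, Pm, Qm)` of `𝔞⁻¹` with scalar `n`, every unit-normalised dual pair `Db`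
of `P.A ⊗ 𝔞⁻¹`, every polarisation `λ_B` EXACT for the cover (`IsExactTwistPol`, row (t3)) and every level structure `η_B` transported along the cover (row (t5)),
and every special point `z₀ = (S.pts Kc)⁻¹[ι₁w, aKc]`: a `λ_B`-witness `Θ` at the sheet point `ℓ_{eE}(z₀)` with a SYMPLECTIC LIFT of `η_B` of type `δ`.
Consumed twice by the glue: `HasType δ` (★ p850691 + ★ `Polarization.exists_mulHom_range_eq_kerPointsAt_of_symplecticLift`) and `IsSymplecticLiftable` (§0).
A `Prop`; NOT asserted here. (print: Lan2013PELCompactifications, §1.3.6 Lemma 1.3.6.5 (p. 81), Lemma 1.3.6.6 and Cor. 1.3.6.7 (pp. 81–82))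
(print: Milne2005ShimuraVarieties, §6 Thm. 6.11 p. 74 and §12 (63) p. 116) (print: Shimura1998, §18.6 Thm. 18.6 pp. 124–125) -/
def OrganB1 : Prop :=
  ∀ (F : Type) [Field F] [NumberField F] [IsCMField F] [IsGalois ℚ F] (ι₁ : F →+* ℂ)
    (Jstar : Matrix (Fin 2) (Fin 2) F) (_hJ : (Jstar.map (IsCMField.complexConj F))ᵀ = Jstar) (_hJu : IsUnit Jstar)
    (K₀ : C5.OpenCompactSubgroup (GSAdele F Jstar)) (S : RecordSystemGS F Jstar ι₁ K₀) (_hU7ₛ : S.HeckeTranslateDefinedOver) (Kc : C5.SmallLevel K₀)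
    (Fi : Type) [Field Fi] [NumberField Fi] [Algebra F Fi] [IsGalois F Fi] (τE : Fi →+* ℂ) (_hτE : τE.comp (algebraMap F Fi) = ι₁)
    (Φ : Set (F →+* ℂ)) (hΦ : IsCMTypeThrough ι₁ Φ) (C : AuxChartGS F ι₁ Jstar K₀ S Kc Fi τE Φ)
    (ξ : F) (k : ℕ) (Fr : SymplecticFrameV F (RingHom.id F) Jstar ((k : ℚ) • ξ) C.g C.δ) (_hpin : IsChartOfFrame hΦ C ξ k Fr)
    (ε : (Literature.AlgebraicGeometry.Motives.baseChange F Fi).obj (S.M.obj Kc) ⟶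
        (Literature.AlgebraicGeometry.Motives.baseChange ℚ Fi).obj C.𝓜.M)
    (_hε : letI : Algebra Fi ℂ := τE.toAlgebra
      ∀ (P : ComplexPoints ((Literature.AlgebraicGeometry.Motives.baseChange F Fi).obj (S.M.obj Kc)))
        (Pflat : letI : Algebra F ℂ := ι₁.toAlgebra; ComplexPoints (S.M.obj Kc)),
        Pflat.left = P.left ≫ pullback.fst (S.M.obj Kc).hom (bcSpec F Fi) →
        (AlgPoints.map ε P).left ≫ pullback.fst C.𝓜.M.hom (bcSpec ℚ Fi) =
          (letI : Algebra F ℂ := ι₁.toAlgebra; (C.f (S.pts Kc Pflat)).left))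
    (ρ : AbelianSchemeOver.RingAction (𝓞 F) (C.𝓜.univ.baseChange (ε.left ≫ pullback.fst C.𝓜.M.hom (bcSpec ℚ Fi))).A),
    RingActionReading C ε ρ →
    ∀ (𝔞 : Ideal (𝓞 F)) (n : ℕ) (t : ↥(torusFinAdelic F)),
      𝔞 ≠ ⊥ → Ideal.span {((n : ℕ) : 𝓞 F)} = 𝔞 * (IsCMField.complexConj F) • 𝔞 → 𝔞 ⊔ Ideal.span {((C.N : ℕ) : 𝓞 F)} = ⊤ →
      FiniteAdeleRing.toFractionalIdeal (𝓞 F) F (t : (FiniteAdeleRing (𝓞 F) F)ˣ) = ((𝔞 : FractionalIdeal (𝓞 F)⁰ F))⁻¹ →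
      (∀ v : HeightOneSpectrum (𝓞 F), Ideal.span {((C.N : ℕ) : 𝓞 F)} ≤ v.asIdeal →
        Valued.v (((t : (FiniteAdeleRing (𝓞 F) F)ˣ) : FiniteAdeleRing (𝓞 F) F) v) = 1 ∧
        Valued.v (((t : (FiniteAdeleRing (𝓞 F) F)ˣ) : FiniteAdeleRing (𝓞 F) F) v - 1) ≤
          WithZero.exp (-(modulusExp (Ideal.span {((C.N : ℕ) : 𝓞 F)}) v : ℤ))) →
      letI P := C.𝓜.univ.baseChange (ε.left ≫ pullback.fst C.𝓜.M.hom (bcSpec ℚ Fi))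
      letI : Algebra F ℂ := ι₁.toAlgebra
  ∀ [IsCommMonObj P.A.X] (m : ℕ) (E' : Matrix (Fin m) (Fin m) (𝓞 F)) (hE' : E' * E' = E') (Pm : Matrix (Fin m) (Fin 1) (𝓞 F))
    (Qm : Matrix (Fin 1) (Fin m) (𝓞 F)),
    E' * Pm = Pm → Qm * E' = Qm → Qm * Pm = Matrix.scalar (Fin 1) ((n : ℕ) : 𝓞 F) → Pm * Qm = Matrix.scalar (Fin m) ((n : ℕ) : 𝓞 F) * E' →
    Ideal.span (Set.range fun j => Pm j 0) = 𝔞 →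
    ∀ (Db : (AbelianSchemeOver.serreTensor ρ E' hE').DualPair)
      (_hDb : Nonempty ((Scheme.Modules.pullback (AbelianSchemeOver.DualPair.unitHatSlice Db)).obj Db.P ≅ SheafOfModules.unit _))
      (polB : (AbelianSchemeOver.serreTensor ρ E' hE').Polarization Db)
      (lvl' : (AbelianSchemeOver.serreTensor ρ E' hE').LevelStructure C.g C.N),
      AbelianSchemeOver.IsExactTwistPol ρ E' hE' Pm P.D Db P.pol n polB.lam →
      (∀ i, lvl'.σ i = P.level.σ i ≫ AbelianSchemeOver.serreTranslate ρ E' hE' Pm) →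
      ∀ (eE : Fi →ₐ[F] ℂ), (∀ x, eE x = τE x) →
        ∀ (w : Fin 2 → F) (hw : (fun i => ι₁ (w i)) ∈ negCone (Jstar.map ι₁)) (a : GSAdele F Jstar),
          ∃ Θ : CartierDivisor ((AbelianSchemeOver.serreTensor ρ E' hE').fibre
              (thickeningLift eE (S.M.obj Kc) ((S.pts Kc).symm (ShimuraSetGS.mk F Jstar ι₁ Kc.1.1 (fun i => ι₁ (w i)) hw a))).left).toAbelianVariety.X.left,
            (AbelianSchemeOver.serreTensor ρ E' hE').IsLambdaOfAt
                (thickeningLift eE (S.M.obj Kc) ((S.pts Kc).symm (ShimuraSetGS.mk F Jstar ι₁ Kc.1.1 (fun i => ι₁ (w i)) hw a))).left Db polB.lam Θ ∧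
              Nonempty (lvl'.SymplecticLift
                (thickeningLift eE (S.M.obj Kc) ((S.pts Kc).symm (ShimuraSetGS.mk F Jstar ι₁ Kc.1.1 (fun i => ι₁ (w i)) hw a))).left Θ C.δ)

/-! ### §2b ORGAN (B2) = DEAL #38 «`ε₂` READS THE TWISTED POINT MAP» -/

set_option maxHeartbeats 400000 in
/-- **ORGAN (B2) = DEAL #38 «`hε₂` — THE POINT READING OF THE CLASSIFYING SLICE OF `T_𝔞`»** (hand: LA4-p02 (g2)).  In the letter՚s chart context, for ideal data
`(𝔞, n)` with rows (c)(a)(b), a torus idèle `t` with `[t] = 𝔞⁻¹` and `t ≡ 1 mod N`, every twisted moduli tuple `T_𝔞 = (P.A ⊗ 𝔞⁻¹, λ_B, η_B) ∈ 𝓜_{g,δ,N}(X)` built on a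
Serre presentation of `𝔞⁻¹` (exact `λ_B`, transported `η_B`), every `Fᵢ`-slice `ε₂ : X → 𝓜.M ⊗ Fᵢ` whose first projection IS the classifying map of `T_𝔞`
(★ `SiegelFineModuliScheme.classifyingMap`, `X` viewed over `ℚ`), and every point map `f₂ : Sh_{Kc}(ℂ) → 𝓜.M(ℂ)` with Siegel shadow `[C.J v, C.b a · ũ_V(1, t)]`
(★ p850526): `ε₂` READS `f₂` on complex points — `(ε₂ P) ≫ pr₁ = f₂ (pts P♭)` whenever `P♭ = P ≫ pr₁` (the `hε₂` binder of ★ p850264 `gal_comp_slice_fst_eq_sliceTwo_fst`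
VERBATIM).  Road: ★ `classifyingMap_comp` at the point, σ1-UNPACK ★ p850665, the marked Serre tensor of the fibre ★ p850517 + (S2b) readings ★ p849685∕p849861∕p849931,
`C.junction` (D3).  A `Prop`; NOT asserted here. (print: Milne2005ShimuraVarieties, §6 Thm. 6.11 p. 74, §14 pp. 124–125) (print: Shimura1998, §18.6 Thm. 18.6 pp. 124–125)
(print: MumfordFogartyKirwan1994, Ch. 7 §3 Theorem 7.9 (p. 139)) -/
def OrganB2 : Prop :=
  ∀ (F : Type) [Field F] [NumberField F] [IsCMField F] [IsGalois ℚ F] (ι₁ : F →+* ℂ)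
    (Jstar : Matrix (Fin 2) (Fin 2) F) (_hJ : (Jstar.map (IsCMField.complexConj F))ᵀ = Jstar) (_hJu : IsUnit Jstar)
    (K₀ : C5.OpenCompactSubgroup (GSAdele F Jstar)) (S : RecordSystemGS F Jstar ι₁ K₀) (_hU7ₛ : S.HeckeTranslateDefinedOver) (Kc : C5.SmallLevel K₀)
    (Fi : Type) [Field Fi] [NumberField Fi] [Algebra F Fi] [IsGalois F Fi] (τE : Fi →+* ℂ) (_hτE : τE.comp (algebraMap F Fi) = ι₁)
    (Φ : Set (F →+* ℂ)) (hΦ : IsCMTypeThrough ι₁ Φ) (C : AuxChartGS F ι₁ Jstar K₀ S Kc Fi τE Φ)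
    (ξ : F) (k : ℕ) (Fr : SymplecticFrameV F (RingHom.id F) Jstar ((k : ℚ) • ξ) C.g C.δ) (_hpin : IsChartOfFrame hΦ C ξ k Fr)
    (ε : (Literature.AlgebraicGeometry.Motives.baseChange F Fi).obj (S.M.obj Kc) ⟶
        (Literature.AlgebraicGeometry.Motives.baseChange ℚ Fi).obj C.𝓜.M)
    (_hε : letI : Algebra Fi ℂ := τE.toAlgebra
      ∀ (P : ComplexPoints ((Literature.AlgebraicGeometry.Motives.baseChange F Fi).obj (S.M.obj Kc)))
        (Pflat : letI : Algebra F ℂ := ι₁.toAlgebra; ComplexPoints (S.M.obj Kc)),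
        Pflat.left = P.left ≫ pullback.fst (S.M.obj Kc).hom (bcSpec F Fi) →
        (AlgPoints.map ε P).left ≫ pullback.fst C.𝓜.M.hom (bcSpec ℚ Fi) =
          (letI : Algebra F ℂ := ι₁.toAlgebra; (C.f (S.pts Kc Pflat)).left))
    (ρ : AbelianSchemeOver.RingAction (𝓞 F) (C.𝓜.univ.baseChange (ε.left ≫ pullback.fst C.𝓜.M.hom (bcSpec ℚ Fi))).A),
    RingActionReading C ε ρ →
    ∀ (𝔞 : Ideal (𝓞 F)) (n : ℕ) (t : ↥(torusFinAdelic F)),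
      𝔞 ≠ ⊥ → Ideal.span {((n : ℕ) : 𝓞 F)} = 𝔞 * (IsCMField.complexConj F) • 𝔞 → 𝔞 ⊔ Ideal.span {((C.N : ℕ) : 𝓞 F)} = ⊤ →
      FiniteAdeleRing.toFractionalIdeal (𝓞 F) F (t : (FiniteAdeleRing (𝓞 F) F)ˣ) = ((𝔞 : FractionalIdeal (𝓞 F)⁰ F))⁻¹ →
      (∀ v : HeightOneSpectrum (𝓞 F), Ideal.span {((C.N : ℕ) : 𝓞 F)} ≤ v.asIdeal →
        Valued.v (((t : (FiniteAdeleRing (𝓞 F) F)ˣ) : FiniteAdeleRing (𝓞 F) F) v) = 1 ∧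
        Valued.v (((t : (FiniteAdeleRing (𝓞 F) F)ˣ) : FiniteAdeleRing (𝓞 F) F) v - 1) ≤
          WithZero.exp (-(modulusExp (Ideal.span {((C.N : ℕ) : 𝓞 F)}) v : ℤ))) →
      letI P := C.𝓜.univ.baseChange (ε.left ≫ pullback.fst C.𝓜.M.hom (bcSpec ℚ Fi))
      letI X := (Literature.AlgebraicGeometry.Motives.baseChange F Fi).obj (S.M.obj Kc)
  ∀ [IsCommMonObj P.A.X] [IsLocallyNoetherian (Over.mk (X.hom ≫ bcSpec ℚ Fi) : SchemeOver ℚ).left] (m : ℕ)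
    (E' : Matrix (Fin m) (Fin m) (𝓞 F)) (hE' : E' * E' = E') (Pm : Matrix (Fin m) (Fin 1) (𝓞 F)) (Qm : Matrix (Fin 1) (Fin m) (𝓞 F)),
    E' * Pm = Pm → Qm * E' = Qm → Qm * Pm = Matrix.scalar (Fin 1) ((n : ℕ) : 𝓞 F) → Pm * Qm = Matrix.scalar (Fin m) ((n : ℕ) : 𝓞 F) * E' →
    Ideal.span (Set.range fun j => Pm j 0) = 𝔞 →
    ∀ (Db : (AbelianSchemeOver.serreTensor ρ E' hE').DualPair)
      (hDb : Nonempty ((Scheme.Modules.pullback (AbelianSchemeOver.DualPair.unitHatSlice Db)).obj Db.P ≅ SheafOfModules.unit _))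
      (polB : (AbelianSchemeOver.serreTensor ρ E' hE').Polarization Db)
      (lvl' : (AbelianSchemeOver.serreTensor ρ E' hE').LevelStructure C.g C.N)
      (hrel : (AbelianSchemeOver.serreTensor ρ E' hE').IsOfRelDim C.g) (hTB : polB.HasType C.δ) (hsB : lvl'.IsSymplecticLiftable polB C.δ),
      AbelianSchemeOver.IsExactTwistPol ρ E' hE' Pm P.D Db P.pol n polB.lam →
      (∀ i, lvl'.σ i = P.level.σ i ≫ AbelianSchemeOver.serreTranslate ρ E' hE' Pm) →
      ∀ (ε₂ : X ⟶ (Literature.AlgebraicGeometry.Motives.baseChange ℚ Fi).obj C.𝓜.M),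
        ε₂.left ≫ pullback.fst C.𝓜.M.hom (bcSpec ℚ Fi) =
          (C.𝓜.classifyingMap (Over.mk (X.hom ≫ bcSpec ℚ Fi) : SchemeOver ℚ)
            (⟨AbelianSchemeOver.serreTensor ρ E' hE', hrel, Db, polB, hTB, lvl', hsB, hDb⟩ :
              PolarizedAbelianSchemeWithLevel C.g C.N C.δ X.left)).left →
        ∀ (f₂ : ShimuraSetGS F Jstar ι₁ Kc.1.1 → ComplexPoints C.𝓜.M),
          (∀ (v : Fin 2 → ℂ) (hv : v ∈ negCone (Jstar.map ι₁)) (a : GSAdele F Jstar),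
            C.pts (AlgPoints.baseChangeEquiv (algebraMap ℚ ℂ) C.𝓜.M (f₂ (ShimuraSetGS.mk F Jstar ι₁ Kc.1.1 v hv a))) =
              SiegelShimuraSet.mk C.δ (principalLevelSubgroup C.δ C.N) ⟨C.J v, C.hJ v hv⟩ (C.b a * auxToGspFinV Fr (1, t))) →
          letI : Algebra Fi ℂ := τE.toAlgebra
          ∀ (Pt : ComplexPoints X) (Pflat : letI : Algebra F ℂ := ι₁.toAlgebra; ComplexPoints (S.M.obj Kc)),
            Pflat.left = Pt.left ≫ pullback.fst (S.M.obj Kc).hom (bcSpec F Fi) →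
            (AlgPoints.map ε₂ Pt).left ≫ pullback.fst C.𝓜.M.hom (bcSpec ℚ Fi) =
              (letI : Algebra F ℂ := ι₁.toAlgebra; (f₂ (S.pts Kc Pflat)).left)

/-! ### §2c ORGAN (B3) = (R-CM) «THE TUPLE ISOMORPHISM INTERTWINES THE ACTIONS AT ONE SPECIAL SHEET POINT PER COMPONENT» -/

set_option maxHeartbeats 400000 in
/-- **ORGAN (B3) = (R-CM) «`hact` AT THE SPECIAL SHEET POINTS»** (hands: LA4-p03 (g3) (R-CM-1∕2) ★-rf `F0P6aSpecialFibreConjugationCentralTwist`, LA6-p02 (g3) (R-CM-3)).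
In the letter՚s chart context, for a junction datum `IsSheetTwistOf ι₁ τE Φ hΦ C.N γ 𝔞 n`, every Serre presentation `(E′, Pm, Qm)` of `𝔞⁻¹` with scalar `n`, every
unit-normalised `Db`, exact `λ_B` and transported `η_B` on `B := P.A ⊗ 𝔞⁻¹`, and EVERY isomorphism of group schemes `E : B ≅ (P.A).baseChange gγ` over `X`
(`gγ := GaloisDescent.gal Fᵢ (M_Kc) γ⁻¹ = 1 × Spec γ`) that is EXACT on the polarisations (`E ≫ λ^γ ≫ E^∨ = λ_B`) and on the level sections (`η_B ≫ E = η^γ`):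
at every special sheet point `ℓ_{eE}(z₀)`, `z₀ = (S.pts Kc)⁻¹[ι₁w, aKc]`, the fibre of `E` intertwines `serreAction` and `ρ^γ := ρ.baseChange gγ` — the `h` of ★ p850641
`RecordSystemGS.forall_comp_eq_comp_of_forall_specialPoint_sheet` VERBATIM (`actA := serreAction ρ E′ hE′`, `actB := ρ.baseChange gγ`, `e := E.hom`).  Road: the CM chain
with central twist at `σL := γ̃` (★ `F0P6aCMHomKernelShape`, ★ p849972, ★ E6-γ), then «the CM hom IS the tuple iso» by Serre rigidity `N ≥ 3`.  A `Prop`; NOT asserted here.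
(print: Kottwitz1992, §5 (p. 390)) (print: MumfordFogartyKirwan1994, Ch. 6 §1 Corollary 6.2 (p. 116) and Corollary 6.4 (p. 117)) (print: Shimura1998, §18.6 Thm. 18.6 pp. 124–125) -/
def OrganB3 : Prop :=
  ∀ (F : Type) [Field F] [NumberField F] [IsCMField F] [IsGalois ℚ F] (ι₁ : F →+* ℂ)
    (Jstar : Matrix (Fin 2) (Fin 2) F) (_hJ : (Jstar.map (IsCMField.complexConj F))ᵀ = Jstar) (_hJu : IsUnit Jstar)
    (K₀ : C5.OpenCompactSubgroup (GSAdele F Jstar)) (S : RecordSystemGS F Jstar ι₁ K₀) (_hU7ₛ : S.HeckeTranslateDefinedOver) (Kc : C5.SmallLevel K₀)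
    (Fi : Type) [Field Fi] [NumberField Fi] [Algebra F Fi] [IsGalois F Fi] (τE : Fi →+* ℂ) (_hτE : τE.comp (algebraMap F Fi) = ι₁)
    (Φ : Set (F →+* ℂ)) (hΦ : IsCMTypeThrough ι₁ Φ) (C : AuxChartGS F ι₁ Jstar K₀ S Kc Fi τE Φ)
    (ξ : F) (k : ℕ) (Fr : SymplecticFrameV F (RingHom.id F) Jstar ((k : ℚ) • ξ) C.g C.δ) (_hpin : IsChartOfFrame hΦ C ξ k Fr)
    (ε : (Literature.AlgebraicGeometry.Motives.baseChange F Fi).obj (S.M.obj Kc) ⟶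
        (Literature.AlgebraicGeometry.Motives.baseChange ℚ Fi).obj C.𝓜.M)
    (_hε : letI : Algebra Fi ℂ := τE.toAlgebra
      ∀ (P : ComplexPoints ((Literature.AlgebraicGeometry.Motives.baseChange F Fi).obj (S.M.obj Kc)))
        (Pflat : letI : Algebra F ℂ := ι₁.toAlgebra; ComplexPoints (S.M.obj Kc)),
        Pflat.left = P.left ≫ pullback.fst (S.M.obj Kc).hom (bcSpec F Fi) →
        (AlgPoints.map ε P).left ≫ pullback.fst C.𝓜.M.hom (bcSpec ℚ Fi) =
          (letI : Algebra F ℂ := ι₁.toAlgebra; (C.f (S.pts Kc Pflat)).left))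
    (ρ : AbelianSchemeOver.RingAction (𝓞 F) (C.𝓜.univ.baseChange (ε.left ≫ pullback.fst C.𝓜.M.hom (bcSpec ℚ Fi))).A),
    RingActionReading C ε ρ →
    ∀ (γ₁ : Fi ≃ₐ[F] Fi) (𝔞 : Ideal (𝓞 F)) (n : ℕ), IsSheetTwistOf ι₁ τE Φ hΦ C.N γ₁ 𝔞 n →
      letI P := C.𝓜.univ.baseChange (ε.left ≫ pullback.fst C.𝓜.M.hom (bcSpec ℚ Fi))
      letI X := (Literature.AlgebraicGeometry.Motives.baseChange F Fi).obj (S.M.obj Kc)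
      letI gγ : X.left ⟶ X.left := Literature.AlgebraicGeometry.Motives.GaloisDescent.gal Fi (S.M.obj Kc) γ₁⁻¹
      letI : Algebra F ℂ := ι₁.toAlgebra
  ∀ [IsCommMonObj P.A.X] (m : ℕ) (E' : Matrix (Fin m) (Fin m) (𝓞 F)) (hE' : E' * E' = E') (Pm : Matrix (Fin m) (Fin 1) (𝓞 F))
    (Qm : Matrix (Fin 1) (Fin m) (𝓞 F)),
    E' * Pm = Pm → Qm * E' = Qm → Qm * Pm = Matrix.scalar (Fin 1) ((n : ℕ) : 𝓞 F) → Pm * Qm = Matrix.scalar (Fin m) ((n : ℕ) : 𝓞 F) * E' →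
    Ideal.span (Set.range fun j => Pm j 0) = 𝔞 →
    ∀ (Db : (AbelianSchemeOver.serreTensor ρ E' hE').DualPair)
      (_hDb : Nonempty ((Scheme.Modules.pullback (AbelianSchemeOver.DualPair.unitHatSlice Db)).obj Db.P ≅ SheafOfModules.unit _))
      (polB : (AbelianSchemeOver.serreTensor ρ E' hE').Polarization Db)
      (lvl' : (AbelianSchemeOver.serreTensor ρ E' hE').LevelStructure C.g C.N),
      AbelianSchemeOver.IsExactTwistPol ρ E' hE' Pm P.D Db P.pol n polB.lam →
      (∀ i, lvl'.σ i = P.level.σ i ≫ AbelianSchemeOver.serreTranslate ρ E' hE' Pm) →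
      ∀ (E : (AbelianSchemeOver.serreTensor ρ E' hE').X ≅ (P.A.baseChange gγ).X) (_ : IsMonHom E.hom),
        E.hom ≫ (P.pol.baseChange gγ).lam ≫ AbelianSchemeOver.DualPair.dualIsogenyOver E.hom Db (P.D.baseChange gγ) = polB.lam →
        (∀ i, lvl'.σ i ≫ E.hom = (P.level.baseChange gγ).σ i) →
        ∀ (eE : Fi →ₐ[F] ℂ), (∀ x, eE x = τE x) →
          ∀ (w : Fin 2 → F) (hw : (fun i => ι₁ (w i)) ∈ negCone (Jstar.map ι₁)) (a : GSAdele F Jstar) (b : 𝓞 F),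
            (Over.pullback (thickeningLift eE (S.M.obj Kc)
                ((S.pts Kc).symm (ShimuraSetGS.mk F Jstar ι₁ Kc.1.1 (fun i => ι₁ (w i)) hw a))).left).map
                ((AbelianSchemeOver.serreAction ρ E' hE').i b ≫ E.hom) =
              (Over.pullback (thickeningLift eE (S.M.obj Kc)
                ((S.pts Kc).symm (ShimuraSetGS.mk F Jstar ι₁ Kc.1.1 (fun i => ι₁ (w i)) hw a))).left).map
                (E.hom ≫ (ρ.baseChange gγ).i b)

/-! ### §2d THE SOCKET TEXT `OrganSHEETGlobal` — tree closer ED. 2 `Lines/F0_P6a_StubESHEET.lean` (sha16 d582eb4401e38ac4) §3c lines 555–610 VERBATIM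
(«ISO» currency, LA4-plan (g2) PEN RULING v2 09:59:53Z = LA7-p01 (g4) frame v1 `OrganSHEETGlobalCore`; here over the Theorems-currency twins and this module՚s `IsSheetTwistOf`). -/

-- Mathlib՚s `Over`∕pull-back API is stated across semireducible wrappers (as in the ★ `AbelianSchemes/*` files and the (W-L4a) leaf): scoped to this declaration.
set_option backward.isDefEq.respectTransparency false in
set_option maxHeartbeats 400000 in
open scoped MonObj Obj in
/-- **`OrganSHEETGlobal` — THE (γ′) GLOBAL SOCKET «SERRE TENSOR OVER X, CLASSIFIED»** (ROAD OF RECORD v3, LA4-plan (g2) 08:48:23Z; the ∃-body = LA4-p01 (g3)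
= LA7-p01 (g4)՚s `OrganSHEETGlobalCore` VERBATIM, the conclusion of LEG-E(γ′) GLOBAL GLUE `organSHEETGlobal_of_organs`; consumed by LA4-p01 (g3)՚s §3c′ reduction after a field-dropping projection):
`OrganSHEET`՚s prefix VERBATIM, then for every sheet twist `IsSheetTwistOf … γE 𝔞 n`: over `X := (Sh_{Kc} ⊗_F Fᵢ).left` there are the twisted `𝒪_F`-PEL tuple
`(B, ρB, DB + Poincaré pin, polB, lvlB)` (LEG-A(γ′) ★ p850615 on `(P.A, ρ)`, `hdual` ★ p850273 + `hproj` ★ p850668, `hT` (N3) ★ p850698∕p850723∕p850691, `hsymp`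
★ p849981∕(m1)), the Serre cover `c : P.A → B` with its GLOBAL rows (t1)(t1′)(t2)(t3)(t4)(t5) for `(𝔞, c•𝔞, n)` (★ p850393∕p850615 conjuncts VERBATIM at `Y := X`),
and a GLOBAL isomorphism of group schemes `E : B ≅ (P.A).baseChange gγ` over `X` (`gγ := GaloisDescent.gal Fᵢ Sh_{Kc} γ₁⁻¹ = 1 × Spec γ₁`) EXACT on the
polarisations (dual-homomorphism form), on the level sections and on the `𝒪_F`-actions (`actB` vs `ρ.baseChange gγ`), plus (surj) and (t5′).  THE ∀∃-BODY IS
LA7-p01 (g4)՚s `OrganSHEETGlobalCore` (HOME `F0/P6/L7/LA7-p01/g4/OrganSHEETGlobalPay.frame.v1.LA7-p01g4.lean` sha16 709ce1f88bbe9864 :701–:735) TOKEN FOR TOKEN —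
ONE DEF, ONE OWNER (pen ruling 09:09:56Z (3); currency settled 10:01Z: «ISO» — ★ `exists_iso_of_tupleRel_id` (`TupleIsoPointCriteria` :90) asks only
`[IsReduced T] [IsLocallyNoetherian T]`, NO `PreconnectedSpace`, and the frame v1 head `organSHEETGlobal_of_organs : OrganB1 → OrganB2 → OrganB3 → OrganSHEETGlobalCore`
is PROVED) — place-free (no `(w, hw)`), `γ₁` (a token clash: `γ` is notation under `open scoped Obj`).  The iso comes from fine moduli (`classifyingMap B = (ε ≫ pr₁) ∘ gγ`:
#42 ★ p850866, #41 ★ p850782∕p850805∕p850830, #38 ★ p850754∕p850842, LEG-C♯ ★ p850759, density ★ p850504, ★ p847561, bridge ★ `exists_iso_of_tupleRel_id`), the action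
clause from (R-CM) ★ p850737∕p850738∕p850815 + (R-RIG) ★ p850641.  Paid by LEG-E(γ′) GLOBAL GLUE (LA7-p01 (g4)
`organSHEETGlobal_of_organs`).  A `Prop`; nothing asserted. (print: Shimura1998, §13.1 Thm. 1 pp. 97–99; §18.6 Thm. 18.6 pp. 124–125)
(print: MumfordFogartyKirwan1994, Ch. 7 §2 Definition 7.2 (p. 129) and Definition 7.3 (p. 130)) (print: Milne2005ShimuraVarieties, §13 Lemma 13.5 and Thm. 13.6 (p. 118)) -/
def OrganSHEETGlobal : Prop :=
  ∀ (F : Type) [Field F] [NumberField F] [IsCMField F] [IsGalois ℚ F] (ι₁ : F →+* ℂ)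
    (Jstar : Matrix (Fin 2) (Fin 2) F) (_hJ : (Jstar.map (IsCMField.complexConj F))ᵀ = Jstar) (_hJu : IsUnit Jstar)
    (K₀ : C5.OpenCompactSubgroup (GSAdele F Jstar)) (S : RecordSystemGS F Jstar ι₁ K₀) (_hU7ₛ : S.HeckeTranslateDefinedOver) (Kc : C5.SmallLevel K₀)
    (Fi : Type) [Field Fi] [NumberField Fi] [Algebra F Fi] [IsGalois F Fi] (τE : Fi →+* ℂ) (_hτE : τE.comp (algebraMap F Fi) = ι₁)
    (Φ : Set (F →+* ℂ)) (hΦ : IsCMTypeThrough ι₁ Φ) (C : AuxChartGS F ι₁ Jstar K₀ S Kc Fi τE Φ)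
    (ξ : F) (k : ℕ) (Fr : SymplecticFrameV F (RingHom.id F) Jstar ((k : ℚ) • ξ) C.g C.δ) (_hpin : IsChartOfFrame hΦ C ξ k Fr)
    (ε : (Literature.AlgebraicGeometry.Motives.baseChange F Fi).obj (S.M.obj Kc) ⟶
        (Literature.AlgebraicGeometry.Motives.baseChange ℚ Fi).obj C.𝓜.M)
    (_hε : letI : Algebra Fi ℂ := τE.toAlgebra
      ∀ (P : ComplexPoints ((Literature.AlgebraicGeometry.Motives.baseChange F Fi).obj (S.M.obj Kc)))
        (Pflat : letI : Algebra F ℂ := ι₁.toAlgebra; ComplexPoints (S.M.obj Kc)),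
        Pflat.left = P.left ≫ pullback.fst (S.M.obj Kc).hom (bcSpec F Fi) →
        (AlgPoints.map ε P).left ≫ pullback.fst C.𝓜.M.hom (bcSpec ℚ Fi) =
          (letI : Algebra F ℂ := ι₁.toAlgebra; (C.f (S.pts Kc Pflat)).left))
    (ρ : AbelianSchemeOver.RingAction (𝓞 F) (C.𝓜.univ.baseChange (ε.left ≫ pullback.fst C.𝓜.M.hom (bcSpec ℚ Fi))).A),
    RingActionReading C ε ρ →
    ∀ (γ₁ : Fi ≃ₐ[F] Fi) (𝔞 : Ideal (𝓞 F)) (n : ℕ), IsSheetTwistOf ι₁ τE Φ hΦ C.N γ₁ 𝔞 n →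
      letI P := C.𝓜.univ.baseChange (ε.left ≫ pullback.fst C.𝓜.M.hom (bcSpec ℚ Fi))
      letI X := (Literature.AlgebraicGeometry.Motives.baseChange F Fi).obj (S.M.obj Kc)
      letI gγ : X.left ⟶ X.left := Literature.AlgebraicGeometry.Motives.GaloisDescent.gal Fi (S.M.obj Kc) γ₁⁻¹
  ∃ (B : AbelianSchemeOver X.left) (actB : AbelianSchemeOver.RingAction (𝓞 F) B) (DB : B.DualPair)
    (_ : Nonempty ((Scheme.Modules.pullback (AbelianSchemeOver.DualPair.unitHatSlice DB)).obj DB.P ≅ SheafOfModules.unit _))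
    (polB : B.Polarization DB) (lvlB : B.LevelStructure C.g C.N) (c : P.A.X ⟶ B.X) (_ : IsMonHom c),
    (∀ x ∈ 𝔞, ∃ d : B.X ⟶ P.A.X, IsMonHom d ∧ c ≫ d = ρ.i x ∧ d ≫ c = actB.i x) ∧
    (∀ ⦃T : Over X.left⦄ (t : T ⟶ P.A.X), t ≫ c = 1 ↔ ∀ x ∈ 𝔞, t ≫ ρ.i x = 1) ∧
    Function.Surjective c.left.base ∧
    (∀ y ∈ (IsCMField.complexConj F) • 𝔞, ∃ f : P.A.X ⟶ B.X, IsMonHom f ∧ c ≫ actB.i y = f ≫ actB.i ((n : ℕ) : 𝓞 F)) ∧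
    c ≫ polB.lam ≫ AbelianSchemeOver.DualPair.dualIsogenyOver c P.D DB = P.pol.lam ≫ P.D.hat.mulN n ∧
    (∀ x : 𝓞 F, ρ.i x ≫ c = c ≫ actB.i x) ∧
    (∀ i, lvlB.σ i = P.level.σ i ≫ c) ∧
    (∀ a : Fin C.g ⊕ Fin C.g → ZMod C.N, lvlB.section_ a = P.level.section_ a ≫ c) ∧
    ∃ (E : B.X ≅ (P.A.baseChange gγ).X) (_ : IsMonHom E.hom),
      E.hom ≫ (P.pol.baseChange gγ).lam ≫ AbelianSchemeOver.DualPair.dualIsogenyOver E.hom DB (P.D.baseChange gγ) = polB.lam ∧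
      (∀ i, lvlB.σ i ≫ E.hom = (P.level.baseChange gγ).σ i) ∧
      ∀ b : 𝓞 F, actB.i b ≫ E.hom = E.hom ≫ (ρ.baseChange gγ).i b



/-! ### §2e The chart sheet as an `F`-algebra hom -/

/-- The chart sheet `τE` as an `F`-algebra hom `Fᵢ →ₐ[F] ℂ` (`ℂ` an `F`-algebra through `ι₁`; `τE ∘ (F → Fᵢ) = ι₁`). [folklore] -/
def sheetHom {F : Type} [Field F] (ι₁ : F →+* ℂ) {Fi : Type} [Field Fi] [Algebra F Fi] (τE : Fi →+* ℂ)
    (hτE : τE.comp (algebraMap F Fi) = ι₁) : letI : Algebra F ℂ := ι₁.toAlgebra; Fi →ₐ[F] ℂ :=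
  letI : Algebra F ℂ := ι₁.toAlgebra
  { τE with commutes' := fun r => RingHom.congr_fun hτE r }

end Summit.HodgeConjecture.HodgeConjecture.Theorems.F0P6aStubESHEETGlobalGlue

end
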